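import Mathlib
import Summits.ValiantsHypothesis.ValiantsHypothesis.Theorems.ProofCarryingSymmetryRestorationQPACFlatten

/-!
# Route ProofCarryingSymmetry — crux `RestorationQP`, line `registered`, stub S3 (`stub_stabilityAtACBudget`), part 3:
the group action on AC-classes, the reachable sub-DAG of a circuit, and its size

Continuation of `…RestorationQPACFlatten.lean` (`ACStability.ACClass`, the AC-quotient DAG):

* a group `Γ` acting on the variables acts on formulas (by renaming) and on AC-classes, compatibly
  with `label`, `size`, `eval`, `kids` and multiplicities (`ACClass.kids_smul`, `count_kids_smul`);
* `ACClass.reach t` — the finite set of classes reachable from `t` along `kids` (the gates of the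
  AC-canonical circuit of part 4), closed under `kids`, contained in the classes of subformulas of a
  representative, and `Γ`-stable as soon as `t` is `Γ`-fixed (`smul_mem_reach`);
* for a Hrubeš–Tzameret circuit `C`: `topClass C = ⟦C•⟧`; AC-provability of `C ∘ γ = C` within a
  budget vanishing on A6–A10 fixes `topClass C` (`topClass_smul_eq_of_hasPCProof`, from AC-soundness,
  part 1) — the registered helper `stabilityAtACBudget_aux_topClass` (the line's budget, over `ℂ`).
  (The size bookkeeping — `(reach (topClass C)).card ≤ |C| + 1`, multiplicities `< 2^(|C|+1)` — is
  part 4, `…ACUnfoldSize.lean`.)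

Everything proved; no named facts.
-/

-- single-problem summit: `Summit.ValiantsHypothesis.ValiantsHypothesis.…` is the namespace by design (D-0017)
set_option linter.dupNamespace false

noncomputable section

open scoped Classical

namespace Summit.ValiantsHypothesis.ValiantsHypothesis.Theorems

namespace ACStability

open Literature.Computability.AlgebraicComplexity

universe u v

variable {𝔽 : Type u} {X : Type v}

namespace ACClass

/-! ### A group acting on the variables acts on formulas and on classes -/

section Action

variable {Γ : Type*} [Group Γ] [MulAction Γ X]

/-- `Γ` acts on formulas by renaming the leaves. [folklore] -/
instance instMulActionFormula : MulAction Γ (PIFormula 𝔽 X) where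
  smul γ F := F.rename fun x => γ • x
  one_smul F := by
    change F.rename _ = F
    simp only [one_smul]
    exact rename_id' F
  mul_smul γ δ F := by
    change F.rename _ = (F.rename _).rename _
    rw [rename_rename']
    congr 1
    funext x
    simp [mul_smul]

/-- The action on formulas is renaming. [folklore] -/
theorem smul_formula_def (γ : Γ) (F : PIFormula 𝔽 X) : γ • F = F.rename fun x => γ • x := rfl

/-- `Γ` acts on AC-classes (renaming respects `ACEq`). [folklore] -/
instance instMulAction : MulAction Γ (ACClass 𝔽 X) where
  smul γ := Quotient.map (γ • ·) fun _ _ h => ACEq.rename _ h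
  one_smul q := by
    induction q using Quotient.inductionOn with
    | h F => exact congrArg mk (one_smul Γ F)
  mul_smul γ δ q := by
    induction q using Quotient.inductionOn with
    | h F => exact congrArg mk (mul_smul γ δ F)

/-- The action on a representative. [folklore] -/
@[simp] theorem smul_mk (γ : Γ) (F : PIFormula 𝔽 X) : γ • mk F = mk (F.rename fun x => γ • x) := rfl

/-- The action transforms labels as Dawar–Wilsenach's action on gate labels. [folklore] -/
theorem label_smul (γ : Γ) (q : ACClass 𝔽 X) : (γ • q).label = γ • q.label := by
  induction q using Quotient.inductionOn with
  | h F => exact headLabel_rename γ F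

/-- The action preserves sizes. [folklore] -/
@[simp] theorem size_smul (γ : Γ) (q : ACClass 𝔽 X) : (γ • q).size = q.size := by
  induction q using Quotient.inductionOn with
  | h F => exact PIFormula.size_rename _ F

/-- The action renames the computed polynomial. [folklore] -/
theorem eval_smul [CommSemiring 𝔽] (γ : Γ) (q : ACClass 𝔽 X) :
    (γ • q).eval = MvPolynomial.rename (fun x => γ • x) q.eval := by
  induction q using Quotient.inductionOn with
  | h F => exact PIFormula.eval_rename _ F

/-- The action maps children to children. [folklore] -/
theorem kids_smul (γ : Γ) (q : ACClass 𝔽 X) : (γ • q).kids = q.kids.map (γ • ·) := by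
  induction q using Quotient.inductionOn with
  | h F =>
    simp only [smul_mk, kids_mk, kids_rename, Multiset.map_coe, List.map_map]
    rfl

/-- Membership in the children of a translate. [folklore] -/
theorem mem_kids_smul_iff (γ : Γ) {q k : ACClass 𝔽 X} : k ∈ (γ • q).kids ↔ γ⁻¹ • k ∈ q.kids := by
  rw [kids_smul, Multiset.mem_map]
  constructor
  · rintro ⟨k', hk', rfl⟩; simpa using hk'
  · intro h; exact ⟨γ⁻¹ • k, h, by simp⟩

/-- Multiplicities of children are preserved by the action. [folklore] -/
theorem count_kids_smul (γ : Γ) (q k : ACClass 𝔽 X) :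
    (γ • q).kids.count (γ • k) = q.kids.count k := by
  rw [kids_smul, Multiset.count_map_eq_count' _ _ (MulAction.injective γ)]

/-- A variable class is moved as its variable. [folklore] -/
theorem smul_mk_var (γ : Γ) (x : X) : γ • mk (.var x : PIFormula 𝔽 X) = mk (.var (γ • x)) := rfl

/-- A constant class is fixed. [folklore] -/
theorem smul_mk_const (γ : Γ) (c : 𝔽) : γ • mk (.const c : PIFormula 𝔽 X) = mk (.const c) := rfl

end Action

/-! ### Subformulas and the classes reachable along `kids` -/

/-- All subformulas of a formula (with repetitions), the formula itself first. [folklore] -/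
def subs : PIFormula 𝔽 X → List (PIFormula 𝔽 X)
  | .add F G => .add F G :: (subs F ++ subs G)
  | .mul F G => .mul F G :: (subs F ++ subs G)
  | F => [F]

/-- A formula is a subformula of itself. [folklore] -/
theorem mem_subs_self (F : PIFormula 𝔽 X) : F ∈ subs F := by
  cases F <;> simp [subs]

/-- Subformulas of subformulas are subformulas. [folklore] -/
theorem subs_subset_of_mem {F K : PIFormula 𝔽 X} (h : K ∈ subs F) : ∀ {J}, J ∈ subs K → J ∈ subs F := by
  induction F with
  | var x => simp [subs] at h; subst h; exact id
  | const c => simp [subs] at h; subst h; exact id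
  | add F G ihF ihG =>
    intro J hJ
    simp only [subs, List.mem_cons, List.mem_append] at h ⊢
    rcases h with rfl | h | h
    · simpa [subs] using hJ
    · exact Or.inr (Or.inl (ihF h hJ))
    · exact Or.inr (Or.inr (ihG h hJ))
  | mul F G ihF ihG =>
    intro J hJ
    simp only [subs, List.mem_cons, List.mem_append] at h ⊢
    rcases h with rfl | h | h
    · simpa [subs] using hJ
    · exact Or.inr (Or.inl (ihF h hJ))
    · exact Or.inr (Or.inr (ihG h hJ))

/-- Subformulas are at most as large. [folklore] -/
theorem size_le_of_mem_subs {F K : PIFormula 𝔽 X} (h : K ∈ subs F) : K.size ≤ F.size := by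
  induction F with
  | var x => simp [subs] at h; simp [h]
  | const c => simp [subs] at h; simp [h]
  | add F G ihF ihG =>
    simp only [subs, List.mem_cons, List.mem_append] at h
    rcases h with rfl | h | h
    · exact le_rfl
    · exact (ihF h).trans (by simp; omega)
    · exact (ihG h).trans (by simp; omega)
  | mul F G ihF ihG =>
    simp only [subs, List.mem_cons, List.mem_append] at h
    rcases h with rfl | h | h
    · exact le_rfl
    · exact (ihF h).trans (by simp; omega)
    · exact (ihG h).trans (by simp; omega)

/-- `+`-summands are subformulas. [folklore] -/
theorem mem_subs_of_mem_addArgs {F K : PIFormula 𝔽 X} (h : K ∈ addArgs F) : K ∈ subs F := by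
  induction F with
  | add F G ihF ihG =>
    simp only [addArgs_add, List.mem_append] at h
    simp only [subs, List.mem_cons, List.mem_append]
    rcases h with h | h
    · exact Or.inr (Or.inl (ihF h))
    · exact Or.inr (Or.inr (ihG h))
  | _ => simp [addArgs] at h; subst h; exact mem_subs_self _

/-- `×`-factors are subformulas. [folklore] -/
theorem mem_subs_of_mem_mulArgs {F K : PIFormula 𝔽 X} (h : K ∈ mulArgs F) : K ∈ subs F := by
  induction F with
  | mul F G ihF ihG =>
    simp only [mulArgs_mul, List.mem_append] at h
    simp only [subs, List.mem_cons, List.mem_append]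
    rcases h with h | h
    · exact Or.inr (Or.inl (ihF h))
    · exact Or.inr (Or.inr (ihG h))
  | _ => simp [mulArgs] at h; subst h; exact mem_subs_self _

/-- Flattened children are subformulas. [folklore] -/
theorem mem_subs_of_mem_kids {F K : PIFormula 𝔽 X} (h : K ∈ ACStability.kids F) : K ∈ subs F := by
  cases F with
  | var x => simp at h
  | const c => simp at h
  | add F G =>
    simp only [kids_add, List.mem_append] at h
    simp only [subs, List.mem_cons, List.mem_append]
    rcases h with h | h
    · exact Or.inr (Or.inl (mem_subs_of_mem_addArgs h))
    · exact Or.inr (Or.inr (mem_subs_of_mem_addArgs h))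
  | mul F G =>
    simp only [kids_mul, List.mem_append] at h
    simp only [subs, List.mem_cons, List.mem_append]
    rcases h with h | h
    · exact Or.inr (Or.inl (mem_subs_of_mem_mulArgs h))
    · exact Or.inr (Or.inr (mem_subs_of_mem_mulArgs h))

/-- The number of flattened children is less than the size. [folklore] -/
theorem length_kids_lt_size (F : PIFormula 𝔽 X) : (ACStability.kids F).length < F.size := by
  have hA : ∀ F : PIFormula 𝔽 X, (addArgs F).length ≤ F.size := by
    intro F; induction F with
    | add F G ihF ihG => simp; omega
    | _ => simp [addArgs]
  have hM : ∀ F : PIFormula 𝔽 X, (mulArgs F).length ≤ F.size := by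
    intro F; induction F with
    | mul F G ihF ihG => simp; omega
    | _ => simp [mulArgs]
  cases F with
  | var x => simp
  | const c => simp
  | add F G => have := hA F; have := hA G; simp; omega
  | mul F G => have := hM F; have := hM G; simp; omega

/-- `Reaches t q`: the class `q` is reachable from `t` along `kids`. [folklore] -/
def Reaches (t q : ACClass 𝔽 X) : Prop :=
  Relation.ReflTransGen (fun a b : ACClass 𝔽 X => b ∈ a.kids) t q

/-- A class reachable from `⟦F⟧` is the class of a subformula of `F`. [folklore] -/
theorem exists_mem_subs_of_reaches {F : PIFormula 𝔽 X} {q : ACClass 𝔽 X} (h : Reaches (mk F) q) :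
    ∃ K ∈ subs F, q = mk K := by
  induction h with
  | refl => exact ⟨F, mem_subs_self F, rfl⟩
  | tail _ hk ih =>
    obtain ⟨K, hK, rfl⟩ := ih
    simp only [kids_mk, Multiset.mem_coe, List.mem_map] at hk
    obtain ⟨J, hJ, rfl⟩ := hk
    exact ⟨J, subs_subset_of_mem hK (mem_subs_of_mem_kids hJ), rfl⟩

/-- Only finitely many classes are reachable from a class. [folklore] -/
theorem finite_reaches (t : ACClass 𝔽 X) : {q | Reaches t q}.Finite := by
  induction t using Quotient.inductionOn with
  | h F =>
    refine (((subs F).map mk).finite_toSet).subset fun q hq => ?_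
    obtain ⟨K, hK, rfl⟩ := exists_mem_subs_of_reaches hq
    exact List.mem_map.2 ⟨K, hK, rfl⟩

/-- `reach t`: the finite set of classes reachable from `t` along `kids`. [folklore] -/
def reach (t : ACClass 𝔽 X) : Finset (ACClass 𝔽 X) := (finite_reaches t).toFinset

/-- Membership in `reach`. [folklore] -/
theorem mem_reach {t q : ACClass 𝔽 X} : q ∈ reach t ↔ Reaches t q :=
  (finite_reaches t).mem_toFinset

/-- `t` is reachable from itself. [folklore] -/
theorem self_mem_reach (t : ACClass 𝔽 X) : t ∈ reach t := mem_reach.2 Relation.ReflTransGen.refl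

/-- `reach t` is closed under children. [folklore] -/
theorem mem_reach_of_mem_kids {t q k : ACClass 𝔽 X} (hq : q ∈ reach t) (hk : k ∈ q.kids) : k ∈ reach t :=
  mem_reach.2 ((mem_reach.1 hq).tail hk)

/-- The classes reachable from `⟦F⟧` are among the classes of the subformulas of `F`. [folklore] -/
theorem reach_mk_subset (F : PIFormula 𝔽 X) : reach (mk F) ⊆ (subs F).toFinset.image mk := by
  intro q hq
  obtain ⟨K, hK, rfl⟩ := exists_mem_subs_of_reaches (mem_reach.1 hq)
  exact Finset.mem_image.2 ⟨K, List.mem_toFinset.2 hK, rfl⟩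

/-- Reachability is transported by the action. [folklore] -/
theorem Reaches.smul {Γ : Type*} [Group Γ] [MulAction Γ X] (γ : Γ) {t q : ACClass 𝔽 X}
    (h : Reaches t q) : Reaches (γ • t) (γ • q) := by
  induction h with
  | refl => exact Relation.ReflTransGen.refl
  | tail _ hk ih => exact ih.tail ((mem_kids_smul_iff γ).2 (by simpa using hk))

/-- If `t` is fixed by `γ`, then `reach t` is `γ`-stable. [folklore] -/
theorem smul_mem_reach {Γ : Type*} [Group Γ] [MulAction Γ X] {γ : Γ} {t q : ACClass 𝔽 X}
    (ht : γ • t = t) (hq : q ∈ reach t) : γ • q ∈ reach t := by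
  have := (mem_reach.1 hq).smul γ
  rw [ht] at this
  exact mem_reach.2 this

end ACClass

/-! ### The top class of a circuit -/

section Circuit

open ACClass

/-- The AC-class of the unfolding of a Hrubeš–Tzameret circuit. [folklore] -/
def topClass [Zero 𝔽] (C : PICircuit 𝔽 X) : ACClass 𝔽 X := ACClass.mk C.unfold

/-- Translating the top class is renaming the circuit. [folklore] -/
theorem smul_topClass [Zero 𝔽] {Γ : Type*} [Group Γ] [MulAction Γ X] (γ : Γ) (C : PICircuit 𝔽 X) :
    γ • topClass C = topClass (C.rename fun x => γ • x) := by
  simp only [topClass, smul_mk, PICircuit.unfold_rename]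

/-- **AC-provable invariance fixes the top class**: if `C ∘ γ = C` has a `P_c` proof within a
budget vanishing on A6–A10, then `γ • topClass C = topClass C`. [folklore] -/
theorem topClass_smul_eq_of_hasPCProof [CommSemiring 𝔽] {Γ : Type*} [Group Γ] [MulAction Γ X]
    {γ : Γ} {C : PICircuit 𝔽 X} {b : PIAxiom → ℕ∞} (hb : ∀ s, IsNonAC s → b s = 0)
    (h : HasPCProof (C.rename fun x => γ • x) C b) : γ • topClass C = topClass C := by
  rw [smul_topClass]
  exact mk_eq_mk.2 (acEq_unfold_of_hasPCProof hb h)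

end Circuit

end ACStability

open Literature.Computability.AlgebraicComplexity in
/-- **AC-provable invariance fixes the AC-class of the circuit** (registered helper of stub S3
`stub_stabilityAtACBudget`, crux `RestorationQP`): if all invariance identities `C ∘ σ = C` have
`P_c(ℂ)` proofs without A6–A10, then every `σ ∈ S_n` fixes `topClass C = ⟦C•⟧`. [folklore] -/
theorem stabilityAtACBudget_aux_topClass : ∀ (n : ℕ) (C : PICircuit ℂ (Fin n × Fin n)), (∀ σ : Equiv.Perm (Fin n), HasPCProof (C.rename fun x : Fin n × Fin n => σ • x) C (fun s => if s = PIAxiom.A6 ∨ s = PIAxiom.A7 ∨ s = PIAxiom.A8 ∨ s = PIAxiom.A9 ∨ s = PIAxiom.A10 then 0 else ⊤)) → ∀ σ : Equiv.Perm (Fin n), σ • ACStability.topClass C = ACStability.topClass C := by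
  intro n C h σ
  exact ACStability.topClass_smul_eq_of_hasPCProof (fun s hs => if_pos hs) (h σ)

end Summit.ValiantsHypothesis.ValiantsHypothesis.Theorems

end
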